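import Summits.MatrixMultiplication.OmegaCensus.STPP222Pow5AssemblyKit

/-!
# ω-census, `N₅` assembly: the Boolean route checker `covered5` and its soundness

HONEST FRAMING (pub-omega census; verbatim): lottery ticket; floor = certified bounds/negative ranges.
Census STRUCTURE bookkeeping (question Q7 of the pub-omega cell, the uniform threshold `N₅`), not progress on `ω`: a
`(2,2,2)⁵` family certifies no matrix-multiplication bound of interest.

For a multiset `M` of prime-power moduli (the elementary divisors of a block of `Π j, ℤ/q j`), `covered5 M` checks ONE of:
(R1) some modulus `x ≥ 3` leaves a rest of product `≥ 46` (`(2,2,2)³` on the rest by `N₃ = 46`, times a tricolored-sum-free pair of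
`ℤ/x`, NR142); (R2) `M` dominates one of the 51 seed SHAPES `seedShapes` (lists of moduli of kernel `(2,2,2)⁵` hosts of the tree,
`STPP222Pow5SeedsHigh/Mid`, `STPP222Pow5NonCyclicWitnesses` in prime-power coordinates); (R3) `M = A + B` with `(2,2,2)^a` on the
`A`-block by a uniform law (`host`: `N₁ = 10` or a dominated `(ℤ/2)³`, `(2,2,2)² ≥ 26`, `N₃ = 46`) and a tricolored-sum-free set of
size `need a = ⌈5/a⌉` on the `B`-block (`tsfGE`: one coordinate, a coprime pair, an order-16 table type, or — recursively on a
split of `B` — the TSF graph or a product of TSF sets).  `covered5_sound`: if the moduli of a block pass `covered5` and every seed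
shape hosts `(2,2,2)⁵` (hypothesis `hseeds`, discharged from the witness files in `STPP222Pow5From94Final.lean`), then
`(2,2,2)⁵ ⊆ Π j, ℤ/q j` (kit `STPP222Pow5AssemblyKit.lean`).  The kernel decision over all capped multisets and the assembly are in
`STPP222Pow5From94.lean`.  The functions are mirrored exactly by the seat's planner `model5.py` (HOME `pub-omega-stpp-3-g11/code/`).

References: H. Cohn, R. Kleinberg, B. Szegedy, C. Umans, FOCS 2005 (arXiv:math/0511460), Def. 5.1; J. Blasiak et al., Discrete
Analysis 2017:3, Def. 3.1.  Seat pub-omega-stpp-3 (gen 11), 2026-08-25.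
-/

open Literature.Computability.AlgebraicComplexity Literature.Combinatorics.Additive Finset

namespace Summit.MatrixMultiplication.OmegaCensus

namespace N5From94

open N5Kit

/-! ## 1. The Boolean route checker -/

/-- Kernel-reducible `∃ x ∈ M, p x` for a multiset (explicit instance, as in `dom`). -/
def anyM {α : Type} (M : Multiset α) (p : α → Bool) : Bool :=
  @decide (∃ x ∈ M, p x = true)
    (@Multiset.decidableExistsMultiset α M (fun x => p x = true) (fun _ => instDecidableEqBool _ _))

/-- Unfolding `anyM`. -/
theorem anyM_iff {α : Type} {M : Multiset α} {p : α → Bool} : anyM M p = true ↔ ∃ x ∈ M, p x = true := by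
  simp only [anyM, decide_eq_true_eq]

/-- The four order-16 table types carrying a tricolored sum-free set of size 6 (`STPPTricoloredToolkit.lean`). -/
def tables6 : List (List ℕ) := [[4, 4], [2, 8], [2, 2, 4], [2, 2, 2, 2]]

/-- The order-16 table types carry tricolored sum-free sets of size 6 (the explicit sets of `STPPTricoloredToolkit.lean`,
re-decided on the seed types). [cite: BlasiakChurchCohnGrochowNaslundSawinUmans2017, Def. 3.1] -/
theorem hasTSF_tables6 : ∀ s ∈ tables6, HasTSF (SeedType s) 6 := by
  intro s hs
  simp only [tables6, List.mem_cons, List.not_mem_nil, or_false] at hs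
  rcases hs with rfl | rfl | rfl | rfl
  · exact (⟨![(0,0), (0,1), (1,0), (1,1), (1,3), (3,1)], ![(0,0), (0,1), (1,0), (2,2), (2,1), (1,2)],
      ![(0,0), (0,2), (2,0), (1,1), (1,0), (0,1)], by unfold IsTricoloredSumFree; decide⟩  : HasTSF (ZMod 4 × ZMod 4) 6)
  · exact (⟨![(0,0), (0,1), (0,4), (1,2), (1,3), (1,4)], ![(0,0), (0,1), (1,2), (1,1), (0,5), (1,3)],
      ![(0,0), (0,6), (1,2), (0,5), (1,0), (0,1)], by unfold IsTricoloredSumFree; decide⟩  : HasTSF (ZMod 2 × ZMod 8) 6)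
  · exact (⟨![(0,0,0), (0,0,1), (0,0,2), (0,1,2), (1,0,1), (1,1,0)], ![(0,0,0), (0,1,0), (1,0,0), (1,1,1), (1,1,2), (1,1,3)],
      ![(0,0,0), (0,1,3), (1,0,2), (1,0,1), (0,1,1), (0,0,1)], by unfold IsTricoloredSumFree; decide⟩  : HasTSF (ZMod 2 × ZMod 2 × ZMod 4) 6)
  · exact (⟨![(0,0,0,0), (0,0,0,1), (0,1,0,0), (0,1,1,0), (1,0,0,1), (1,0,1,0)],
      ![(0,0,0,0), (0,0,1,0), (1,0,0,0), (1,0,1,1), (1,1,1,0), (1,1,1,1)],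
      ![(0,0,0,0), (0,0,1,1), (1,1,0,0), (1,1,0,1), (0,1,1,1), (0,1,0,1)], by unfold IsTricoloredSumFree; decide⟩  : HasTSF (ZMod 2 × ZMod 2 × ZMod 2 × ZMod 2) 6)

/-- Base TSF supplies of a block with moduli `B`, size `≥ t`: trivial (`t ≤ 1`), one modulus `x` with `tsfCyc x ≥ t`, a coprime
pair `x, y` with `tsfCyc (x y) ≥ t`, or (`t ≤ 6`) a dominated order-16 table type. -/
def tsfBase (t : ℕ) (B : Multiset ℕ) : Bool :=
  decide (t ≤ 1) || anyM B (fun x => decide (t ≤ tsfCyc x)) ||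
    anyM B (fun x => anyM (B.erase x) (fun y => decide (Nat.Coprime x y ∧ t ≤ tsfCyc (x * y)))) ||
    (decide (t ≤ 6) && tables6.any (fun s => dom s B))

/-- TSF supplies of a block with moduli `B`, size `≥ t`, with `fuel` levels of splitting: the base supplies, or a split
`B = B₂ + (B − B₂)` carrying the TSF GRAPH (both parts of order `≥ t`) or a PRODUCT of TSFs (sizes `2` and `⌈t/2⌉`). -/
def tsfGE : ℕ → ℕ → Multiset ℕ → Bool
  | 0, t, B => tsfBase t B
  | fuel + 1, t, B => tsfBase t B ||
      anyM B.powerset (fun B₂ => decide (t ≤ B₂.prod ∧ t ≤ (B - B₂).prod) ||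
        (tsfGE fuel 2 B₂ && tsfGE fuel ((t + 1) / 2) (B - B₂)))

/-- The number `a ≤ 3` of triples the uniform laws put on a block with moduli `A`: `3` for order `≥ 46`, `2` for `≥ 26`, `1` for
`≥ 10` or a dominated `(ℤ/2)³`, else `0`. -/
def host (A : Multiset ℕ) : ℕ :=
  if 46 ≤ A.prod then 3 else if 26 ≤ A.prod then 2 else if 10 ≤ A.prod ∨ dom [2, 2, 2] A = true then 1 else 0

/-- The TSF size needed next to `a` triples: `⌈5/a⌉`. -/
def need (a : ℕ) : ℕ := if a = 3 then 2 else if a = 2 then 3 else 5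

/-- The 51 seed SHAPES: lists of prime-power moduli `s` such that `SeedType s = ℤ/s₁ × (ℤ/s₂ × ⋯)` hosts `(2,2,2)⁵` by a kernel
witness of the tree (`STPP222Pow5SeedsHigh/Mid.lean`, `STPP222Pow5NonCyclicWitnesses.lean` in prime-power coordinates; the witnesses
are attached in `STPP222Pow5From94Final.lean`), ordered by first-hit frequency in the kernel decision. -/
def seedShapes : List (List ℕ) :=
  [[2, 4, 4, 4], [5, 5, 5], [2, 2, 2, 2, 2, 3], [2, 2, 3, 3, 3], [2, 2, 4, 8], [4, 4, 8], [2, 8, 8], [2, 5, 2, 5], [11, 11],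
   [2, 2, 2, 4, 3], [3, 3, 3, 4], [2, 4, 4, 3], [7, 2, 7], [3, 3, 3, 5], [2, 4, 16], [8, 16], [2, 2, 3, 9], [2, 9, 9], [5, 4, 5],
   [2, 2, 8, 3], [4, 8, 3], [5, 25], [2, 2, 4, 7], [4, 4, 7], [2, 2, 32], [4, 32], [3, 3, 11], [5, 5, 7], [2, 2, 4, 9], [3, 4, 9],
   [4, 4, 9], [3, 3, 13], [4, 5, 8], [2, 3, 3, 7], [3, 5, 9], [5, 5, 9], [2, 16, 3], [2, 2, 25], [2, 4, 13], [2, 2, 27], [2, 7, 8],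
   [2, 2, 29], [2, 3, 4, 5], [2, 2, 31], [2, 64], [2, 2, 3, 11], [2, 4, 17], [2, 8, 9], [2, 2, 37], [2, 4, 19], [2, 2, 41]]

/-- `seedShapes` has 51 entries. -/
theorem length_seedShapes : seedShapes.length = 51 := rfl

/-- `M` dominates one of the 51 seed shapes. -/
def seedHit (M : Multiset ℕ) : Bool := seedShapes.any fun s => dom s M

/-- **The route checker**: (R1) a modulus `x ≥ 3` with rest of product `≥ 46`; or a dominated seed; or a split `M = A + B` with
`host A ≠ 0` and a TSF set of size `need (host A)` on `B`. -/
def covered5 (M : Multiset ℕ) : Bool :=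
  anyM M (fun x => decide (3 ≤ x ∧ 46 * x ≤ M.prod)) || seedHit M ||
    anyM M.powerset (fun B => decide (host (M - B) ≠ 0) && tsfGE (Multiset.card M) (need (host (M - B))) B)

/-! ## 2. Soundness of the route checker -/

variable {ι : Type} [Fintype ι] [DecidableEq ι] {q : ι → ℕ}

omit [Fintype ι] in
/-- Soundness of the base supplies. -/
theorem tsfBase_sound (hq : ∀ i, 0 < q i) {t : ℕ} (S : Finset ι) (h : tsfBase t (S.val.map q) = true) : TSFOn q S t := by
  simp only [tsfBase, Bool.or_eq_true, Bool.and_eq_true, decide_eq_true_eq, anyM_iff, List.any_eq_true] at h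
  rcases h with ((h1 | ⟨x, hx, hxt⟩) | ⟨x, hx, y, hy, hcop, hyt⟩) | ⟨h6, s, hs, hdom⟩
  · exact tsfOn_of_le_one S h1
  · obtain ⟨i, hi, rfl⟩ := Multiset.mem_map.1 hx
    exact tsfOn_single S hi hxt
  · obtain ⟨i, hi, rfl⟩ := Multiset.mem_map.1 hx
    obtain ⟨i', hi', rfl⟩ := Multiset.mem_map.1 (Multiset.mem_of_mem_erase hy)
    exact tsfOn_pair S hi hi' hcop hyt
  · exact (tsfOn_of_dom hq S hdom (hasTSF_tables6 s hs)).mono (Subset.refl _) h6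

/-- **Soundness of `tsfGE`**: a block whose moduli pass `tsfGE fuel t` carries a tricolored sum-free set of size `t` (induction
on `fuel`; a chosen sub-multiset is the multiset of moduli of a sub-block, `exists_subset_map_eq`). -/
theorem tsfGE_sound (hq : ∀ i, 0 < q i) : ∀ (fuel t : ℕ) (S : Finset ι), tsfGE fuel t (S.val.map q) = true → TSFOn q S t
  | 0, _, S, h => tsfBase_sound hq S h
  | fuel + 1, t, S, h => by
      rw [tsfGE, Bool.or_eq_true] at h
      rcases h with h | h
      · exact tsfBase_sound hq S h
      rw [anyM_iff] at h
      obtain ⟨B₂, hB₂, h⟩ := h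
      rw [Multiset.mem_powerset] at hB₂
      obtain ⟨T, hTS, hT⟩ := exists_subset_map_eq q S B₂ hB₂
      have hdiff : S.val.map q - B₂ = (S \ T).val.map q := by rw [← hT, map_val_sdiff q hTS]
      have hun : T ∪ S \ T = S := Finset.union_sdiff_of_subset hTS
      rw [hdiff, ← hT, Bool.or_eq_true, decide_eq_true_eq, Bool.and_eq_true] at h
      rw [← hun]
      rcases h with ⟨h2, h3⟩ | ⟨h2, h3⟩
      · exact tsfOn_graph hq Finset.disjoint_sdiff h2 h3
      · exact (tsfOn_mul Finset.disjoint_sdiff (tsfGE_sound hq fuel 2 T h2) (tsfGE_sound hq fuel _ (S \ T) h3)).mono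
          (Subset.refl _) (by omega)

/-- `host` never exceeds `3`. -/
theorem host_le (A : Multiset ℕ) : host A ≤ 3 := by
  unfold host; split_ifs <;> omega

/-- `a · need a ≥ 5` for `1 ≤ a ≤ 3`. -/
theorem five_le_mul_need {a : ℕ} (h0 : a ≠ 0) (h3 : a ≤ 3) : 5 ≤ a * need a := by
  have h1 : 1 ≤ a := Nat.pos_of_ne_zero h0
  unfold need; interval_cases a <;> decide

/-- Soundness of `host`: the uniform laws on the block. -/
theorem stppOn_host (hq : ∀ i, 0 < q i) (S : Finset ι) (h : host (S.val.map q) ≠ 0) :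
    STPPOn q S (host (S.val.map q)) := by
  unfold host at h ⊢
  split_ifs at h ⊢ with h46 h26 h10
  · exact stppOn_three hq S h46
  · exact stppOn_two hq S h26
  · rcases h10 with h10 | hdom
    · exact stppOn_one hq S h10
    · exact stppOn_of_dom222 hq S hdom
  · exact absurd rfl h

/-- **Soundness of the route checker**: if the multiset of moduli of a block `S` is `covered5`, then `(2,2,2)⁵ ⊆ Π j, ℤ/q j`.
[cite: CohnKleinbergSzegedyUmans2005, Def. 5.1] -/
theorem covered5_sound (hseeds : ∀ s ∈ seedShapes, HasPow (SeedType s) 5) (hq : ∀ i, 0 < q i) (S : Finset ι)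
    (h : covered5 (S.val.map q) = true) : HasPow (Π j, ZMod (q j)) 5 := by
  simp only [covered5, seedHit, Bool.or_eq_true, Bool.and_eq_true, decide_eq_true_eq, anyM_iff, List.any_eq_true] at h
  rcases h with (⟨x, hx, h3, h46⟩ | ⟨sd, hsd, hdom⟩) | ⟨B, hB, hhost, htsf⟩
  · -- (R1): `(2,2,2)³` on `S \ {i}` times a TSF pair in `ℤ/q i`
    obtain ⟨i, hi, rfl⟩ := Multiset.mem_map.1 hx
    have hi' : i ∈ S := hi
    have hsub : ({i} : Finset ι) ⊆ S := Finset.singleton_subset_iff.2 hi'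
    have hrest : (S.val.map q).prod = q i * ((S \ {i}).val.map q).prod := by
      rw [map_val_sdiff q hsub, ← Multiset.prod_erase hx]
      congr 1
      simp
    have h46' : 46 ≤ ((S \ {i}).val.map q).prod := Nat.le_of_mul_le_mul_left (by rw [← hrest]; linarith) (hq i)
    have hdisj : Disjoint (S \ {i}) {i} := Finset.sdiff_disjoint
    exact hasPow_of_parts hdisj (stppOn_three hq _ h46')
      (tsfOn_single {i} (Finset.mem_singleton_self i) (t := 2) (by unfold tsfCyc; split_ifs <;> omega)) (by norm_num)
  · exact hasPow_of_dom hq S hdom (hseeds sd hsd)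
  · rw [Multiset.mem_powerset] at hB
    obtain ⟨T, hTS, hT⟩ := exists_subset_map_eq q S B hB
    have hdiff : S.val.map q - B = (S \ T).val.map q := by rw [← hT, map_val_sdiff q hTS]
    rw [hdiff] at hhost htsf
    rw [← hT] at htsf
    exact hasPow_of_parts Finset.sdiff_disjoint (stppOn_host hq (S \ T) hhost) (tsfGE_sound hq _ _ T htsf)
      (five_le_mul_need hhost (host_le _))

end N5From94

end Summit.MatrixMultiplication.OmegaCensus
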